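import Literature.ComputerArithmetic.LangeRump2018.Ufp
import Literature.ComputerArithmetic.Higham2002.Gamma
import Mathlib.Algebra.BigOperators.Fin
import Mathlib.Data.List.OfFn

/-!
# Jeannerod–Rump 2013: the forward error of an inner product in ANY evaluation order — the first
# standard model with gradual underflow, `Bₙ = (1+u)ⁿ − 1`, `γₙ`, and the underflow term

HONEST FRAMING (ENGINES group, engine `cap`, part CAP-2): shared numerical engines serving client
cells; rigour lives in the verifiers; every published number belongs to a client cell's ledger, not
to the engines group. This file turns the one floating-point modelling assumption of the `flt`
certificate kinds of `cap.spectral` — "a matrix product computes every entry as a sum of `n` rounded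
products in binary64 in SOME order (blocking / FMA allowed): `|fl(xᵀy) − xᵀy| ≤ γₙ |x|ᵀ|y| + n·η`" —
into theorems over the IEEE model already in the tree (`JeannerodRump2018/Summation.lean`:
`IsFloat p emin` = precision `p`, gradual underflow from exponent `emin`, no overflow;
`IsRoundNearest` = ANY round-to-nearest map; `unitRoundoff p = 2^{-p}`). Binary64 is
`(p, emin) = (53, −1074)`: `u = 2⁻⁵³`, `η := 2^emin = 2⁻¹⁰⁷⁴` (the smallest positive subnormal).

SOURCE: C.-P. Jeannerod and S. M. Rump, *Improved error bounds for inner products in floating-point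
arithmetic*, SIAM J. Matrix Anal. Appl. 34(2) (2013) 338–344 [JeannerodRump2013] (read in the held
copy `paper:doi-10-1137-120894488`, HAL hal-00840926). Setting of its §2 (p. 339): `F` the finite
IEEE floating-point numbers of radix `β`, precision `p`, symmetric (2.1); `fl` ANY round-to-nearest
map, "|fl(t) − t| = min_{s ∈ F} |s − t|" (2.2), no tie rule; `u = ½β^{1−p}` — here `β = 2`.
What is typed, against the paper:

* (1.1)/(2.3) [pp. 338, 340] "for `t ∈ ℝ` and in the absence of underflow and overflow,
  `|fl(t) − t| ≤ u·ufp(t) ≤ u|t|`": PROVED as `abs_fl_sub_le_mul_abs` (normal range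
  `2^(emin+p−1) ≤ |t|`), with its gradual-underflow complement `abs_fl_sub_le_half_eta`
  (`|t| < 2^(emin+p) ⟹ |fl(t) − t| ≤ η/2`: the floats there are the multiples of `η` — the fact
  behind Lemma 2.2's "if `a + b` is in the subnormal range of `F` then it equals `fl(a + b)`",
  p. 340), the combined FIRST STANDARD MODEL WITH UNDERFLOW `abs_fl_sub_le`
  (`|fl(t) − t| ≤ u|t| + η/2` for every `t`) and its sharp bookkeeping form `abs_fl_sub_le_uflow`
  (`… + U(t)·η/2`, `U(t) ∈ {0,1}` the UNDERFLOW INDICATOR `uflow`: the rounding is tiny AND inexact,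
  as IEEE 754 signals it; `uflow_add_eq_zero`: the sum of two floats never underflows).
* (1.2) [p. 338] "Given input vectors `x, y ∈ Fⁿ` and barring underflow and overflow, the repeated
  application of (1.1) gives `|float(xᵀy) − xᵀy| ≤ Bₙ|x|ᵀ|y|` with `Bₙ = (1 + u)ⁿ − 1` for all
  `n`", `float(·)` meaning evaluation "no matter what the order of evaluation" (p. 338): PROVED for
  every evaluation scheme `DotTree` (below) as `DotTree.abs_eval_sub_exact_le_of_uflows_eq_zero`, a
  corollary of the MASTER BOUND WITH UNDERFLOW `DotTree.abs_eval_sub_exact_le_uflows`: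
  `|r̂ − Σzᵢ| ≤ ((1+u)ⁿ − 1)·Σ|zᵢ| + (1+u)ⁿ·N·η/2`, `N` = the number of roundings of the evaluation
  that underflow, `N ≤ n` (`DotTree.uflows_le`, `DotTree.abs_eval_sub_exact_le`). As the paper
  remarks (p. 341), the bound "holds more generally when summing the rounded values `fl(zᵢ)` of the
  entries of a real vector `z`": the leaves `zᵢ` are arbitrary.
* (1.3) [p. 338] "`Bₙ` is bounded by the commonly used quantity `γₙ = nu/(1 − nu)` if `nu < 1`"
  (`Higham2002.one_add_pow_sub_one_le_gamma`, [Higham2002ASNA, Lemma 3.1]): the ENGINE FORM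
  `DotTree.abs_eval_sub_exact_le_gamma` — `2nu ≤ 1 ⟹ |r̂ − Σzᵢ| ≤ γₙ·Σ|zᵢ| + n·η` — and, for
  `zᵢ = xᵢyᵢ` in any order, `abs_dot_sub_le_gamma`: `|r̂ − xᵀy| ≤ γₙ |x|ᵀ|y| + n·η`, literally the
  engine's assumption (its side condition `2nu ≤ 1` reads `n ≤ 2⁵²` in binary64).
* Proposition 3.1 [p. 340] "for `x₁, …, xₙ ∈ F`, any order of evaluation of the sum `Σxᵢ` produces
  an approximation `r̂` such that, in the absence of overflow, `|r̂ − Σxᵢ| ≤ (n − 1)u Σ|xᵢ|`":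
  PROVED (`proposition31`) from the sharper `(n−1)u/(1+u)` of `JeannerodRump2018.sumError_le_holds`.

EVALUATION SCHEMES (`DotTree`). The paper's "`float(expression)` … no matter what the order of
evaluation … recursive summation and pairwise summation, but also any other scheme" (p. 338) and
"this covers in particular blocking strategies, but not more sophisticated methods as by Strassen"
(p. 343, footnote 2): a binary tree whose internal nodes are single roundings `fl(l + r)` and whose
leaves hold the terms `zᵢ`, each either rounded on its own (`rleaf z`: a floating-point product
`fl(xᵢyᵢ)`) or kept exact and absorbed by the ONE rounding of its parent (`xleaf z`: a fused
multiply-add `fl(s + xᵢyᵢ)` of IEEE 754-2008 — an extension of the paper's setting which the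
`(1+u)ⁿ`-type bounds tolerate, an FMA rounding once where multiply-then-add rounds twice). Every
entry of a matrix product computed by `n` multiplications and `n − 1` additions in binary64 in any
blocking, vectorisation or accumulation order, with or without FMA, is such an evaluation with
`n` leaves; Strassen-type algorithms are not, exactly as in the paper.

DELIBERATELY NOT HERE: Proposition 4.1 / Theorem 4.2 (the `O(u²)`-free factor `nu` in place of
`γₙ`, no underflow, no FMA; pp. 341–342) — the engine uses `γₙ`, and a faithful typing of the
paper's blanket "no underflow" regime is left to the venture that needs it; overflow (excluded by
the model, as in `Summation.lean`; the engine checks all arrays finite); radices `β ≠ 2`.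
-/

namespace Literature.ComputerArithmetic.JeannerodRump2013

open Literature.ComputerArithmetic.JeannerodRump2018
open Literature.ComputerArithmetic.LangeRump2018 (isFloat_zpow abs_sub_fl_le_ufp_pos)
open Literature.ComputerArithmetic.Higham2002 (gamma)

variable {p : ℕ} {emin : ℤ} {fl : ℚ → ℚ}

/-! ### The unit roundoff `u = 2^{-p}` and the underflow unit `η = 2^{emin}` -/

/-- `u = 2^{-p} > 0`. [cite: JeannerodRump2013, §2] -/
theorem unitRoundoff_pos (p : ℕ) : 0 < unitRoundoff p := by
  unfold unitRoundoff; positivity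

/-- `u · 2^(emin+p-1) = η/2`: `u` times the smallest normal number `2^(emin+p-1)` is half the float
spacing `η = 2^emin` of the gradual-underflow range. [cite: JeannerodRump2013, §2 eq. (2.3)] -/
theorem unitRoundoff_mul_zpow (p : ℕ) (emin : ℤ) :
    unitRoundoff p * (2 : ℚ) ^ (emin + p - 1) = (2 : ℚ) ^ emin / 2 := by
  have h2 : (2 : ℚ) ≠ 0 := by norm_num
  have hp0 : (2 : ℚ) ^ (p : ℕ) ≠ 0 := by positivity
  have hz : (2 : ℚ) ^ (emin + p - 1) = (2 : ℚ) ^ emin * (2 : ℚ) ^ (p : ℕ) / 2 := by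
    rw [zpow_sub₀ h2, zpow_add₀ h2, zpow_natCast, zpow_one]
  rw [hz]
  unfold unitRoundoff
  rw [one_div_mul_eq_div, div_eq_iff hp0]
  ring

/-! ### Rounding to nearest with gradual underflow -/

/-- GRADUAL-UNDERFLOW RANGE, nonnegative argument: for `0 ≤ t < 2^(emin+p)` the two neighbours
`m·2^emin ≤ t ≤ (m+1)·2^emin` are floats (the floats below `2^(emin+p)` are exactly the multiples of
`2^emin`), hence `|t - fl t| ≤ 2^emin / 2`. This is the fact behind "if `a + b` is in the subnormal
range of `F` then it equals `fl(a + b)`". [cite: JeannerodRump2013, Lemma 2.2 (proof, p. 340)] -/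
theorem abs_sub_fl_le_half_eta_pos (hp : 1 ≤ p) (hfl : IsRoundNearest p emin fl) {t : ℚ}
    (ht0 : 0 ≤ t) (ht : t < (2 : ℚ) ^ (emin + p)) : |t - fl t| ≤ (2 : ℚ) ^ emin / 2 := by
  have h2 : (2 : ℚ) ≠ 0 := by norm_num
  set c : ℚ := (2 : ℚ) ^ emin with hc
  have hcpos : 0 < c := zpow_pos (by norm_num) _
  have htop : (2 : ℚ) ^ (emin + p) = ((2 ^ p : ℤ) : ℚ) * c := by
    rw [hc, zpow_add₀ h2, zpow_natCast]; push_cast; ring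
  set m := ⌊t / c⌋ with hm
  have hm_le : (m : ℚ) ≤ t / c := Int.floor_le _
  have hm_lt : t / c < m + 1 := Int.lt_floor_add_one _
  have hm0 : (0 : ℤ) ≤ m := by rw [hm]; exact Int.floor_nonneg.mpr (div_nonneg ht0 hcpos.le)
  have hm_lt' : m < (2 ^ p : ℤ) := by
    rw [hm, Int.floor_lt, div_lt_iff₀ hcpos]
    rw [htop] at ht; exact_mod_cast ht
  have hf1 : IsFloat p emin ((m : ℚ) * c) := by
    refine isFloat_of_int_mul m emin ?_ le_rfl
    rw [abs_of_nonneg hm0]; exact hm_lt'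
  have hf2 : IsFloat p emin (((m + 1 : ℤ) : ℚ) * c) := by
    rcases lt_or_eq_of_le (Int.add_one_le_iff.mpr hm_lt') with hlt | heq
    · refine isFloat_of_int_mul (m + 1) emin ?_ le_rfl
      rw [abs_of_nonneg (by linarith)]; exact hlt
    · rw [heq, ← htop]; exact isFloat_zpow hp (by omega)
  have e1 := abs_sub_fl_le hfl t hf1
  have e2 := abs_sub_fl_le hfl t hf2
  have hf1le : (m : ℚ) * c ≤ t := by rwa [le_div_iff₀ hcpos] at hm_le
  have hf2ge : t ≤ ((m + 1 : ℤ) : ℚ) * c := by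
    push_cast; rw [div_lt_iff₀ hcpos] at hm_lt; linarith
  rw [abs_of_nonneg (by linarith : 0 ≤ t - m * c)] at e1
  rw [abs_of_nonpos (by linarith : t - ((m + 1 : ℤ) : ℚ) * c ≤ 0)] at e2
  push_cast at e2
  have hsplit : (((m : ℚ) + 1) * c) = (m : ℚ) * c + c := by ring
  rw [hsplit] at e2
  linarith

/-- GRADUAL-UNDERFLOW RANGE: `|t| < 2^(emin+p) ⟹ |fl t - t| ≤ η/2`, `η = 2^emin` (by the symmetry
(2.1) of `F` the mirrored map `t ↦ -fl(-t)` is again a round-to-nearest, so `t ≥ 0` suffices).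
[cite: JeannerodRump2013, Lemma 2.2 (proof, p. 340) with (2.1)–(2.2)] -/
theorem abs_fl_sub_le_half_eta (hp : 1 ≤ p) (hfl : IsRoundNearest p emin fl) {t : ℚ}
    (ht : |t| < (2 : ℚ) ^ (emin + p)) : |fl t - t| ≤ (2 : ℚ) ^ emin / 2 := by
  rcases le_or_gt 0 t with h0 | hneg
  · rw [abs_sub_comm]
    exact abs_sub_fl_le_half_eta_pos hp hfl h0 (by rwa [abs_of_nonneg h0] at ht)
  · have h := abs_sub_fl_le_half_eta_pos hp hfl.neg (t := -t) (by linarith)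
      (by rwa [abs_of_neg hneg] at ht)
    simp only [neg_neg] at h
    rw [show fl t - t = -t - -fl t by ring]; exact h

/-- (2.3), NORMAL RANGE ("in the absence of underflow"): `2^(emin+p-1) ≤ |t| ⟹ |fl t - t| ≤ u|t|`
— above `2^(emin+p)` from `|fl t - t| ≤ u·ufp(t)` (`LangeRump2018.abs_sub_fl_le_ufp_pos`), and on
the first normal binade `[2^(emin+p-1), 2^(emin+p))` because the spacing there is `η = 2u·2^(emin+p-1)`.
[cite: JeannerodRump2013, §2 eq. (2.3)] -/
theorem abs_fl_sub_le_mul_abs (hp : 1 ≤ p) (hfl : IsRoundNearest p emin fl) {t : ℚ}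
    (ht : (2 : ℚ) ^ (emin + p - 1) ≤ |t|) : |fl t - t| ≤ unitRoundoff p * |t| := by
  have pos : ∀ g : ℚ → ℚ, IsRoundNearest p emin g → ∀ s : ℚ, (2 : ℚ) ^ (emin + p - 1) ≤ s →
      |s - g s| ≤ unitRoundoff p * s := by
    intro g hg s hs
    have hspos : 0 < s := lt_of_lt_of_le (zpow_pos (by norm_num) _) hs
    rcases le_or_gt ((2 : ℚ) ^ (emin + p)) s with hbig | hsmall
    · have h1 := abs_sub_fl_le_ufp_pos hp hg hbig
      have h2 : ((2 : ℕ) : ℚ) ^ (Int.log 2 s) ≤ s := Int.zpow_log_le_self (by norm_num) hspos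
      push_cast at h2
      exact le_trans h1 (mul_le_mul_of_nonneg_left h2 (unitRoundoff_pos p).le)
    · have h1 := abs_sub_fl_le_half_eta_pos hp hg hspos.le hsmall
      rw [← unitRoundoff_mul_zpow p emin] at h1
      exact le_trans h1 (mul_le_mul_of_nonneg_left hs (unitRoundoff_pos p).le)
  rcases le_or_gt 0 t with h0 | hneg
  · rw [abs_of_nonneg h0] at ht ⊢
    rw [abs_sub_comm]; exact pos fl hfl t ht
  · rw [abs_of_neg hneg] at ht ⊢
    have h := pos _ hfl.neg (-t) ht
    simp only [neg_neg] at h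
    rw [show fl t - t = -t - -fl t by ring]; exact h

/-- FIRST STANDARD MODEL WITH GRADUAL UNDERFLOW: for EVERY `t`, `|fl t - t| ≤ u|t| + η/2`
(`η = 2^emin`; the `η/2` is needed only in the gradual-underflow range, cf. the paper's remark
before Proposition 4.1 that without it products `xᵢyᵢ = β^{2emin}` round to `0`).
[cite: JeannerodRump2013, §2 eq. (2.3) and §4 (remark before Prop. 4.1, p. 341)] -/
theorem abs_fl_sub_le (hp : 1 ≤ p) (hfl : IsRoundNearest p emin fl) (t : ℚ) :
    |fl t - t| ≤ unitRoundoff p * |t| + (2 : ℚ) ^ emin / 2 := by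
  have hu0 : 0 ≤ unitRoundoff p * |t| := mul_nonneg (unitRoundoff_pos p).le (abs_nonneg t)
  have hη : 0 ≤ (2 : ℚ) ^ emin / 2 := by positivity
  rcases lt_or_ge |t| ((2 : ℚ) ^ (emin + p - 1)) with hsmall | hbig
  · have h := abs_fl_sub_le_half_eta hp hfl
      (lt_trans hsmall (zpow_lt_zpow_right₀ (by norm_num) (by omega)))
    linarith
  · have h := abs_fl_sub_le_mul_abs hp hfl hbig
    linarith

/-- UNDERFLOW INDICATOR of one rounding: `1` if rounding `t` underflows — `t` is tiny
(`|t| < 2^(emin+p-1)`, below the normal range; tininess taken before rounding) AND the rounding is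
inexact, which is when IEEE 754 signals underflow by default —, else `0`.
[cite: JeannerodRump2013, §4 (remark before Prop. 4.1, p. 341)] -/
def uflow (p : ℕ) (emin : ℤ) (fl : ℚ → ℚ) (t : ℚ) : ℕ :=
  if |t| < (2 : ℚ) ^ (emin + p - 1) ∧ fl t ≠ t then 1 else 0

/-- `uflow ≤ 1`. [cite: JeannerodRump2013, §4] -/
theorem uflow_le_one (p : ℕ) (emin : ℤ) (fl : ℚ → ℚ) (t : ℚ) : uflow p emin fl t ≤ 1 := by
  unfold uflow; split_ifs <;> simp

/-- FIRST STANDARD MODEL, sharp bookkeeping form: `|fl t - t| ≤ u|t| + U(t)·η/2` with `U(t) ∈ {0,1}`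
the underflow indicator — normal range: (2.3); tiny and exact: no error; tiny and inexact: `η/2`.
[cite: JeannerodRump2013, §2 eq. (2.3) and Lemma 2.2] -/
theorem abs_fl_sub_le_uflow (hp : 1 ≤ p) (hfl : IsRoundNearest p emin fl) (t : ℚ) :
    |fl t - t| ≤ unitRoundoff p * |t| + (uflow p emin fl t : ℚ) * ((2 : ℚ) ^ emin / 2) := by
  have hu0 : 0 ≤ unitRoundoff p * |t| := mul_nonneg (unitRoundoff_pos p).le (abs_nonneg t)
  have hη : 0 ≤ (2 : ℚ) ^ emin / 2 := by positivity
  unfold uflow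
  split_ifs with h
  · have h1 := abs_fl_sub_le_half_eta hp hfl
      (lt_trans h.1 (zpow_lt_zpow_right₀ (by norm_num) (by omega)))
    push_cast; linarith
  · by_cases htiny : |t| < (2 : ℚ) ^ (emin + p - 1)
    · have hex : fl t = t := by
        by_contra hne; exact h ⟨htiny, hne⟩
      rw [hex, sub_self, abs_zero]; push_cast; linarith
    · have h1 := abs_fl_sub_le_mul_abs hp hfl (not_lt.mp htiny)
      push_cast; linarith

/-- A floating-point ADDITION never underflows: below the normal range the sum of two floats is a
float, hence exact ("if `a + b` is in the subnormal range of `F` then it equals `fl(a + b)`").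
[cite: JeannerodRump2013, Lemma 2.2 (p. 340)] -/
theorem uflow_add_eq_zero (hfl : IsRoundNearest p emin fl) {a b : ℚ} (ha : IsFloat p emin a)
    (hb : IsFloat p emin b) : uflow p emin fl (a + b) = 0 := by
  unfold uflow
  split_ifs with h
  · exact absurd (fl_eq_self hfl (isFloat_add_of_small ha hb
      (lt_trans h.1 (zpow_lt_zpow_right₀ (by norm_num) (by omega))))) h.2
  · rfl

/-! ### Evaluation schemes of `Σ zᵢ` / `xᵀy` in any order, with or without fused multiply-add -/

/-- An EVALUATION SCHEME of a sum of `n` terms `zᵢ` (for an inner product, `zᵢ = xᵢyᵢ`) "no matter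
what the order of evaluation": a binary tree; `rleaf z` = the term rounded on its own (`fl z`, a
floating-point multiplication), `xleaf z` = the term kept exact and absorbed by its parent's single
rounding (fused multiply-add), `node l r` = one rounded addition `fl(l̂ + r̂)`.
[cite: JeannerodRump2013, §1 (p. 338) and §5 footnote 2 (p. 343)] -/
inductive DotTree
  | rleaf : ℚ → DotTree
  | xleaf : ℚ → DotTree
  | node : DotTree → DotTree → DotTree

namespace DotTree

/-- The terms `zᵢ`, left to right. [cite: JeannerodRump2013, §1] -/
def leaves : DotTree → List ℚ
  | rleaf z => [z]
  | xleaf z => [z]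
  | node l r => leaves l ++ leaves r

/-- The exact value `Σ zᵢ`. [cite: JeannerodRump2013, §1] -/
def exact : DotTree → ℚ
  | rleaf z => z
  | xleaf z => z
  | node l r => exact l + exact r

/-- The computed value `r̂` with rounding map `fl`: one rounding per `rleaf` and per `node`.
[cite: JeannerodRump2013, §1 eq. (1.2)] -/
def eval (fl : ℚ → ℚ) : DotTree → ℚ
  | rleaf z => fl z
  | xleaf z => z
  | node l r => fl (eval fl l + eval fl r)

/-- Is the tree a bare exact term (an FMA operand)? [cite: JeannerodRump2013, §1] -/
def isX : DotTree → Bool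
  | rleaf _ => false
  | xleaf _ => true
  | node _ _ => false

/-- `Σ |zᵢ|` (for an inner product, `|x|ᵀ|y|`). [cite: JeannerodRump2013, §1 eq. (1.2)] -/
def absSum (t : DotTree) : ℚ := (t.leaves.map abs).sum

/-- `N` = the number of roundings of the evaluation that UNDERFLOW (tiny and inexact): the rounded
terms that do, plus the fused nodes that do (a plain addition of two floats never does,
`uflow_add_eq_zero`). [cite: JeannerodRump2013, §4 (remark before Prop. 4.1, p. 341)] -/
def uflows (p : ℕ) (emin : ℤ) (fl : ℚ → ℚ) : DotTree → ℕ
  | rleaf z => uflow p emin fl z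
  | xleaf _ => 0
  | node l r => uflows p emin fl l + uflows p emin fl r + uflow p emin fl (eval fl l + eval fl r)

/-- A scheme has at least one term. [cite: JeannerodRump2013, §1] -/
theorem one_le_length_leaves : ∀ t : DotTree, 1 ≤ t.leaves.length
  | rleaf _ => by simp [leaves]
  | xleaf _ => by simp [leaves]
  | node l r => by simp [leaves]; have := one_le_length_leaves l; omega

/-- `n(node l r) = n(l) + n(r)`. [cite: JeannerodRump2013, §3 (proof of Prop. 3.1)] -/
theorem length_leaves_node (l r : DotTree) :
    (node l r).leaves.length = l.leaves.length + r.leaves.length := by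
  simp [leaves]

/-- `Σ|zᵢ| ≥ 0`. [cite: JeannerodRump2013, §1] -/
theorem absSum_nonneg (t : DotTree) : 0 ≤ t.absSum :=
  List.sum_nonneg (by intro x hx; obtain ⟨y, -, rfl⟩ := List.mem_map.mp hx; exact abs_nonneg y)

/-- `r̃(node l r) = r̃(l) + r̃(r)`. [cite: JeannerodRump2013, §3 (proof of Prop. 3.1)] -/
theorem absSum_node (l r : DotTree) : (node l r).absSum = l.absSum + r.absSum := by
  simp [absSum, leaves, List.map_append, List.sum_append]

/-- The exact value is the sum of the terms. [cite: JeannerodRump2013, §1] -/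
theorem exact_eq_sum : ∀ t : DotTree, t.exact = t.leaves.sum
  | rleaf z => by simp [exact, leaves]
  | xleaf z => by simp [exact, leaves]
  | node l r => by simp [exact, leaves, List.sum_append, exact_eq_sum l, exact_eq_sum r]

/-- `|Σ zᵢ| ≤ Σ |zᵢ|`. [cite: JeannerodRump2013, §3 (proof of Prop. 3.1)] -/
theorem abs_exact_le_absSum : ∀ t : DotTree, |t.exact| ≤ t.absSum
  | rleaf z => by simp [exact, absSum, leaves]
  | xleaf z => by simp [exact, absSum, leaves]
  | node l r => by
      rw [absSum_node]; simp only [exact]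
      exact le_trans (abs_add_le _ _) (add_le_add (abs_exact_le_absSum l) (abs_exact_le_absSum r))

/-- Every computed value other than a bare exact term is a float. [cite: JeannerodRump2013, §2] -/
theorem isFloat_eval (hfl : IsRoundNearest p emin fl) :
    ∀ t : DotTree, t.isX = false → IsFloat p emin (t.eval fl)
  | rleaf z, _ => (hfl z).1
  | xleaf z, h => by simp [isX] at h
  | node l r, _ => (hfl _).1

/-- A bare exact term has no rounding and one leaf. [cite: JeannerodRump2013, §1] -/
theorem uflows_of_isX : ∀ t : DotTree, t.isX = true → t.uflows p emin fl = 0 ∧ t.leaves.length = 1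
  | rleaf z, h => by simp [isX] at h
  | xleaf z, _ => by simp [uflows, leaves]
  | node l r, h => by simp [isX] at h

/-- `N ≤ n`: at most one underflowing rounding per term (its own rounding, or the fused node that
absorbs it; plain additions never underflow). [cite: JeannerodRump2013, Lemma 2.2 and §4] -/
theorem uflows_le (hfl : IsRoundNearest p emin fl) :
    ∀ t : DotTree, t.uflows p emin fl ≤ t.leaves.length
  | rleaf z => by simpa [uflows, leaves] using uflow_le_one p emin fl z
  | xleaf z => by simp [uflows, leaves]
  | node l r => by
      have ihl := uflows_le hfl l
      have ihr := uflows_le hfl r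
      have hU := uflow_le_one p emin fl (eval fl l + eval fl r)
      rw [length_leaves_node]
      simp only [uflows]
      cases hl : l.isX
      · cases hr : r.isX
        · have h0 := uflow_add_eq_zero hfl (isFloat_eval hfl l hl) (isFloat_eval hfl r hr)
          omega
        · obtain ⟨h1, h2⟩ := uflows_of_isX (p := p) (emin := emin) (fl := fl) r hr
          omega
      · obtain ⟨h1, h2⟩ := uflows_of_isX (p := p) (emin := emin) (fl := fl) l hl
        omega

/-- MASTER BOUND WITH GRADUAL UNDERFLOW ("repeated application of (1.1)", any `n`, any order, fused
multiply-add allowed): `|r̂ − Σzᵢ| ≤ ((1+u)ⁿ − 1)·Σ|zᵢ| + (1+u)ⁿ·N·η/2`, `N` the number of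
underflowing roundings. Induction on the tree as in the proofs of Propositions 3.1/4.1: at the root
`r̂ = fl(r̂₁ + r̂₂)`, `r̂ − r = δ + e₁ + e₂`. [cite: JeannerodRump2013, §1 eq. (1.2) and §4 (p. 341)] -/
theorem abs_eval_sub_exact_le_uflows (hp : 1 ≤ p) (hfl : IsRoundNearest p emin fl) :
    ∀ t : DotTree, |t.eval fl - t.exact|
      ≤ ((1 + unitRoundoff p) ^ t.leaves.length - 1) * t.absSum
        + (1 + unitRoundoff p) ^ t.leaves.length * (t.uflows p emin fl : ℚ) * ((2 : ℚ) ^ emin / 2)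
  | rleaf z => by
      have h := abs_fl_sub_le_uflow hp hfl z
      have hu := (unitRoundoff_pos p).le
      have hη : 0 ≤ (2 : ℚ) ^ emin / 2 := by positivity
      have hN : (0 : ℚ) ≤ (uflow p emin fl z : ℚ) := Nat.cast_nonneg _
      have hx := mul_nonneg (mul_nonneg hu hN) hη
      simp only [eval, exact, uflows, absSum, leaves, List.map_cons, List.map_nil, List.sum_cons,
        List.sum_nil, add_zero, List.length_singleton, pow_one]
      linarith
  | xleaf z => by
      simp only [eval, exact, sub_self, abs_zero, uflows, Nat.cast_zero, mul_zero, zero_mul,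
        add_zero, absSum, leaves, List.map_cons, List.map_nil, List.sum_cons, List.sum_nil,
        List.length_singleton, pow_one]
      nlinarith [unitRoundoff_pos p, abs_nonneg z]
  | node l r => by
      have ihl := abs_eval_sub_exact_le_uflows hp hfl l
      have ihr := abs_eval_sub_exact_le_uflows hp hfl r
      rw [length_leaves_node, absSum_node]
      simp only [eval, exact, uflows, Nat.cast_add]
      -- names
      set u := unitRoundoff p with hu
      set η : ℚ := (2 : ℚ) ^ emin / 2 with hη
      set a := eval fl l with ha
      set b := eval fl r with hb
      set A1 := absSum l with hA1d
      set A2 := absSum r with hA2d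
      set m1 := l.leaves.length with hm1d
      set m2 := r.leaves.length with hm2d
      set N1 : ℚ := (uflows p emin fl l : ℚ) with hN1d
      set N2 : ℚ := (uflows p emin fl r : ℚ) with hN2d
      set U : ℚ := (uflow p emin fl (a + b) : ℚ) with hUd
      set P1 := (1 + u) ^ m1 with hP1d
      set P2 := (1 + u) ^ m2 with hP2d
      set P := (1 + u) ^ (m1 + m2) with hPd
      have hu0 : 0 ≤ u := (unitRoundoff_pos p).le
      have hη0 : 0 ≤ η := by positivity
      have hA1 : 0 ≤ A1 := absSum_nonneg l
      have hA2 : 0 ≤ A2 := absSum_nonneg r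
      have hN1 : 0 ≤ N1 := Nat.cast_nonneg _
      have hN2 : 0 ≤ N2 := Nat.cast_nonneg _
      have hU0 : 0 ≤ U := Nat.cast_nonneg _
      have hm1 : 1 ≤ m1 := one_le_length_leaves l
      have hm2 : 1 ≤ m2 := one_le_length_leaves r
      have h1u : 1 ≤ 1 + u := by linarith
      -- powers
      have hP1 : (1 + u) * P1 ≤ P := by
        have h := pow_le_pow_right₀ h1u (show m1 + 1 ≤ m1 + m2 by omega)
        rw [pow_succ, mul_comm] at h; exact h
      have hP2 : (1 + u) * P2 ≤ P := by
        have h := pow_le_pow_right₀ h1u (show m2 + 1 ≤ m1 + m2 by omega)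
        rw [pow_succ, mul_comm] at h; exact h
      have hPge : 1 ≤ P := one_le_pow₀ h1u
      -- the local rounding error δ and the triangle inequalities
      have hloc : |fl (a + b) - (a + b)| ≤ u * |a + b| + U * η := abs_fl_sub_le_uflow hp hfl (a + b)
      have hxa := abs_exact_le_absSum l
      have hxb := abs_exact_le_absSum r
      have hab : |a + b| ≤ |a - exact l| + A1 + (|b - exact r| + A2) := by
        have e : a + b = (a - exact l) + exact l + ((b - exact r) + exact r) := by ring
        calc |a + b| = |(a - exact l) + exact l + ((b - exact r) + exact r)| := by rw [← e]
          _ ≤ |(a - exact l) + exact l| + |(b - exact r) + exact r| := abs_add_le _ _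
          _ ≤ (|a - exact l| + |exact l|) + (|b - exact r| + |exact r|) :=
              add_le_add (abs_add_le _ _) (abs_add_le _ _)
          _ ≤ _ := by linarith
      have htri : |fl (a + b) - (exact l + exact r)|
          ≤ |fl (a + b) - (a + b)| + |a - exact l| + |b - exact r| := by
        have e : fl (a + b) - (exact l + exact r)
            = (fl (a + b) - (a + b)) + ((a - exact l) + (b - exact r)) := by ring
        rw [e]
        exact le_trans (abs_add_le _ _) (by linarith [abs_add_le (a - exact l) (b - exact r)])
      -- products for the linear bookkeeping
      have t1 := mul_le_mul_of_nonneg_left hab hu0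
      have t2 := mul_le_mul_of_nonneg_left ihl (le_trans zero_le_one h1u)
      have t3 := mul_le_mul_of_nonneg_left ihr (le_trans zero_le_one h1u)
      have t4 := mul_le_mul_of_nonneg_right hP1 hA1
      have t5 := mul_le_mul_of_nonneg_right hP1 (mul_nonneg hN1 hη0)
      have t6 := mul_le_mul_of_nonneg_right hP2 hA2
      have t7 := mul_le_mul_of_nonneg_right hP2 (mul_nonneg hN2 hη0)
      have t8 : U * η ≤ P * (U * η) := le_mul_of_one_le_left (mul_nonneg hU0 hη0) hPge
      linarith

/-- (1.2) VERBATIM, "barring underflow": if no rounding of the evaluation underflows then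
`|r̂ − Σzᵢ| ≤ Bₙ·Σ|zᵢ|`, `Bₙ = (1+u)ⁿ − 1`, for all `n` and every evaluation order.
[cite: JeannerodRump2013, §1 eq. (1.2)] -/
theorem abs_eval_sub_exact_le_of_uflows_eq_zero (hp : 1 ≤ p) (hfl : IsRoundNearest p emin fl)
    (t : DotTree) (h0 : t.uflows p emin fl = 0) :
    |t.eval fl - t.exact| ≤ ((1 + unitRoundoff p) ^ t.leaves.length - 1) * t.absSum := by
  have h := abs_eval_sub_exact_le_uflows hp hfl t
  rw [h0] at h
  simpa using h

/-- THE BOUND WITH GRADUAL UNDERFLOW, for all `n`, every order, FMA or not: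
`|r̂ − Σzᵢ| ≤ ((1+u)ⁿ − 1)·Σ|zᵢ| + (1+u)ⁿ·n·η/2`. [cite: JeannerodRump2013, §1 eq. (1.2) and §4 (p. 341)] -/
theorem abs_eval_sub_exact_le (hp : 1 ≤ p) (hfl : IsRoundNearest p emin fl) (t : DotTree) :
    |t.eval fl - t.exact| ≤ ((1 + unitRoundoff p) ^ t.leaves.length - 1) * t.absSum
      + (1 + unitRoundoff p) ^ t.leaves.length * t.leaves.length * ((2 : ℚ) ^ emin / 2) := by
  have h := abs_eval_sub_exact_le_uflows hp hfl t
  have hN : (t.uflows p emin fl : ℚ) ≤ t.leaves.length := by exact_mod_cast uflows_le hfl t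
  have hP : 0 ≤ (1 + unitRoundoff p) ^ t.leaves.length :=
    pow_nonneg (by linarith [unitRoundoff_pos p]) _
  have hη : 0 ≤ (2 : ℚ) ^ emin / 2 := by positivity
  have := mul_le_mul_of_nonneg_left (mul_le_mul_of_nonneg_right hN hη) hP
  linarith

/-- ENGINE FORM with Higham's `γₙ = nu/(1 − nu)`: if `2nu ≤ 1` then
`|r̂ − Σzᵢ| ≤ γₙ·Σ|zᵢ| + n·η` (`(1+u)ⁿ − 1 ≤ γₙ` and `(1+u)ⁿ ≤ (1 − nu)⁻¹ ≤ 2`).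
[cite: JeannerodRump2013, §1 eqs. (1.2)–(1.3)] -/
theorem abs_eval_sub_exact_le_gamma (hp : 1 ≤ p) (hfl : IsRoundNearest p emin fl) (t : DotTree)
    (hn : 2 * (t.leaves.length : ℚ) * unitRoundoff p ≤ 1) :
    |t.eval fl - t.exact| ≤ gamma (unitRoundoff p) t.leaves.length * t.absSum
      + t.leaves.length * (2 : ℚ) ^ emin := by
  have h := abs_eval_sub_exact_le hp hfl t
  set u := unitRoundoff p with hu
  set n := t.leaves.length with hnd
  have hu0 : 0 ≤ u := (unitRoundoff_pos p).le
  have hnu : (n : ℚ) * u < 1 := by nlinarith [Nat.cast_nonneg (α := ℚ) n]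
  have hg : (1 + u) ^ n - 1 ≤ gamma u n := Higham2002.one_add_pow_sub_one_le_gamma hu0 hnu
  have hP0 : 0 ≤ (1 + u) ^ n := pow_nonneg (by linarith) _
  have hP2 : (1 + u) ^ n ≤ 2 := by
    have h1 := Higham2002.one_add_pow_mul_one_sub_le hu0 n
    have hhalf : (1 : ℚ) / 2 ≤ 1 - (n : ℚ) * u := by linarith
    have := mul_le_mul_of_nonneg_left hhalf hP0
    linarith
  have hA := absSum_nonneg t
  have t1 := mul_le_mul_of_nonneg_right hg hA
  have hη : 0 ≤ (n : ℚ) * ((2 : ℚ) ^ emin / 2) := by positivity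
  have t2 := mul_le_mul_of_nonneg_right hP2 hη
  linarith

end DotTree

/-- THE ENGINE'S ASSUMPTION AS A THEOREM: for `x, y` (any rationals, in particular floats) and ANY
evaluation `t` of `xᵀy` — its `n` terms `xᵢyᵢ` in any order, each rounded by a multiplication or
absorbed by a fused multiply-add, combined by rounded additions in any blocking — if
`2nu ≤ 1` then `|r̂ − xᵀy| ≤ γₙ |x|ᵀ|y| + n·η` (`u = 2^{-p}`, `η = 2^{emin}`; binary64: `u = 2⁻⁵³`,
`η = 2⁻¹⁰⁷⁴`, `n ≤ 2⁵²`). [cite: JeannerodRump2013, §1 eqs. (1.2)–(1.3) and §5 (p. 343)] -/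
theorem abs_dot_sub_le_gamma (hp : 1 ≤ p) (hfl : IsRoundNearest p emin fl) {n : ℕ}
    (x y : Fin n → ℚ) (t : DotTree) (ht : t.leaves.Perm (List.ofFn fun i => x i * y i))
    (hn : 2 * (n : ℚ) * unitRoundoff p ≤ 1) :
    |t.eval fl - ∑ i, x i * y i|
      ≤ gamma (unitRoundoff p) n * ∑ i, |x i| * |y i| + n * (2 : ℚ) ^ emin := by
  have hlen : t.leaves.length = n := by rw [ht.length_eq, List.length_ofFn]
  have hex : t.exact = ∑ i, x i * y i := by
    rw [DotTree.exact_eq_sum, ht.sum_eq, List.sum_ofFn]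
  have habs : t.absSum = ∑ i, |x i| * |y i| := by
    unfold DotTree.absSum
    rw [(ht.map abs).sum_eq, List.map_ofFn, List.sum_ofFn]
    exact Finset.sum_congr rfl (fun i _ => by simp [Function.comp, abs_mul])
  have h := DotTree.abs_eval_sub_exact_le_gamma hp hfl t (by rw [hlen]; exact hn)
  rw [hlen, hex, habs] at h
  exact h

/-! ### Proposition 3.1: any-order summation of floats, `(n−1)u` -/

/-- PROPOSITION 3.1: for `x₁, …, xₙ ∈ F` and any order of evaluation of `Σ xᵢ` (no overflow; gradual
underflow allowed), `|r̂ − Σxᵢ| ≤ (n − 1)u·Σ|xᵢ|` — "valid for any `n` and in particular does not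
require `(n − 1)u < 1`". From the sharper `(n−1)u/(1+u)` of `JeannerodRump2018.sumError_le_holds`.
[cite: JeannerodRump2013, Prop. 3.1 (p. 340)] -/
theorem proposition31 (hp : 2 ≤ p) (hfl : IsRoundNearest p emin fl) (t : SumTree)
    (h : ∀ x ∈ t.leaves, IsFloat p emin x) :
    |t.eval fl - t.exact|
      ≤ ((t.leaves.length : ℚ) - 1) * unitRoundoff p * (t.leaves.map abs).sum := by
  have h1 := sumError_le_holds p emin fl hp hfl t h
  have hn := SumTree.one_le_length_leaves t
  have hcast : ((t.leaves.length - 1 : ℕ) : ℚ) = (t.leaves.length : ℚ) - 1 := by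
    rw [Nat.cast_sub hn]; simp
  rw [hcast] at h1
  have hu := unitRoundoff_pos p
  have hS : 0 ≤ (t.leaves.map abs).sum := SumTree.absSum_nonneg t
  have hle : unitRoundoff p / (1 + unitRoundoff p) ≤ unitRoundoff p := by
    rw [div_le_iff₀ (by linarith)]; nlinarith
  have hn1 : (0 : ℚ) ≤ (t.leaves.length : ℚ) - 1 := by
    have : (1 : ℚ) ≤ t.leaves.length := by exact_mod_cast hn
    linarith
  exact le_trans h1 (mul_le_mul_of_nonneg_right (mul_le_mul_of_nonneg_left hle hn1) hS)

end Literature.ComputerArithmetic.JeannerodRump2013
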